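import Summits.QuantumFields.YangMills.Theorems.SwapVirialDeficitSwapRingMeanActionFixedL
import Summits.QuantumFields.YangMills.Theorems.SwapVirialDeficitToronSoftnessSharpOfTubeLaw
import HarnessLib

/-!
# The fixed-`L` RELATIVE MEAN-ACTION GAP of the σ-glued ring, modulo the two sharp state-density laws
# (fixed-`L` row of the parent crux ⟨stmt-QuantumFields-24194⟩ `SwapVirialDeficit.SwapMeanActionGap`, conditional on the OPEN periodic tube-volume law
# ⟨24497⟩ `ToronValleyVolume.ToronTubeVolumeLaw` and on the principal σ-sector sharp state density (LINE «sharp-sigma» on ⟨24197⟩); free-hands support of ⟨24197⟩)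

★★ `swap_meanActionGap_fixedL_of_laws` — IF the periodic toron-valley tube volume law ⟨24497⟩ holds (whence ✓`SectorMixture.toronSoftnessSharp_of_toronTubeVolumeLaw`:
`β(log Z)′ ≥ 12βL⁴ − 9L⁴ + 3/2 − ε` on windows, in particular at every fixed `L ≥ L₀` for `β ≥ β₀(L)`) AND the principal σ-sector deficit `F^S_{000}` has a
sharp state density at `L` (✓`swap_meanAction_fixedL_of_principalLaw`: `β(log Z^S)′ = 12βL⁴ − (9L⁴ − 1) + O(β^{−θ''})`), THEN at that `L`, for all large `β`,
`β·(log Z^S)′(β) − β·(log Z)′(β) ≤ −1/4`: the σ-glued ring is STIFFER than the periodic one by a fixed amount of mean action — the fixed-`L` instance, with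
`c = 1/4`, of `SwapMeanActionGap` (prediction `c → 1/2 + 1/log β`, instrument j320281: `0.483 ± 0.038`).
HONEST LABEL: fixed-`L` bookkeeping CONDITIONAL on two OPEN sharp laws (⟨24497⟩ and the principal σ state density); the crux ⟨24194⟩ is window-uniform and
stays OPEN, as do ⟨24197⟩/⟨24196⟩/⟨24497⟩; the Yang–Mills mass gap is NOT proved; no summit is proved by a line.
Width seat ym-line-sfw-p2-w2 g55 (cell ym-idea-1, free hands; own crux ⟨22884⟩ blocked-on ⟨19935⟩), `--supports stmt-QuantumFields-24197`.
THEOREMS ONLY (0 `def`, 0 `sorry`), standard axioms.  References: [cite: tHooft1979]; [cite: Luscher1983, §2]; [cite: Griffiths1964]; [cite: TomboulisYaffe1985]; [folklore].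
-/

set_option autoImplicit false

noncomputable section

open MeasureTheory Set Filter Topology
open scoped BigOperators ENNReal Nat
open Literature.MathematicalPhysics.QuantumFieldTheory hiding SU2
open Literature.MathematicalPhysics.QuantumLattice

namespace Summit.QuantumFields.YangMills.Theorems.SwapVirialDeficit.SwapRing

open Summit.QuantumFields.YangMills.Theorems.FemtoTransferGap
open Summit.QuantumFields.YangMills.Theorems.FemtoTransferGap.TT
open Summit.QuantumFields.YangMills.Theorems.VirialFluxGap.RingDeficit
open Summit.QuantumFields.YangMills.Theorems.SwapVirialDeficit.SectorMixture (toronSoftnessSharp_of_toronTubeVolumeLaw)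

/-- ★★ **THE FIXED-`L` RELATIVE GAP, modulo the two sharp laws.**  From the periodic tube-volume law ⟨24497⟩ (through
✓`toronSoftnessSharp_of_toronTubeVolumeLaw` at `ε = 1/8`, restricted to fixed `L ≥ L₀`) and the sharp state density of `F^S_{000}` at `L` (through
✓`swap_meanAction_fixedL_of_principalLaw`, deviation `≤ 1/8` eventually): `β(log Z^S)′ − β(log Z)′ ≤ (12βL⁴ − 9L⁴ + 1 + 1/8) − (12βL⁴ − 9L⁴ + 3/2 − 1/8) = −1/4`
for all `β ≥ β₀(L)`. [cite: tHooft1979] [cite: Griffiths1964] [cite: TomboulisYaffe1985] -/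
theorem swap_meanActionGap_fixedL_of_laws (hV : Summit.QuantumFields.YangMills.Theses.ToronValleyVolume.ToronTubeVolumeLaw) :
    ∃ L₀ : ℕ, ∀ (L : ℕ) [NeZero L], L₀ ≤ L → ∀ {v κ θ t₀ : ℝ}, 0 < v → 0 ≤ κ → 0 < θ → θ ≤ 1 → 0 < t₀ →
      (∀ t : ℝ, 0 < t → t ≤ t₀ →
        |(ringMeasure L).real {P | swapRingDeficit L (fun _ => false) P ≤ t} / (v * t ^ (9 * L ^ 4 - 1)) - 1| ≤ κ * t ^ θ) →
      ∃ β₀ : ℝ, ∀ β : ℝ, β₀ ≤ β →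
        β * deriv (fun b : ℝ => Real.log (TT.twistTrace L b (2 * L))) β -
          β * deriv (fun b : ℝ => Real.log (TT.physTrace L b (2 * L))) β ≤ -(1 / 4 : ℝ) := by
  -- the periodic side: sharp toron softness at `ε = 1/8` on a window, hence at every fixed `L ≥ L₀`
  obtain ⟨a, ha, βp, L₀, hper⟩ := toronSoftnessSharp_of_toronTubeVolumeLaw hV (1 / 8) (by norm_num)
  refine ⟨L₀, fun L _ hL v κ θ t₀ hv hκ hθ hθ1 ht₀ hvol => ?_⟩
  -- the swap side: the fixed-`L` mean action modulo the principal law, deviation `≤ 1/8` eventually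
  obtain ⟨K, θ'', β₂, hθ'', hswap⟩ := swap_meanAction_fixedL_of_principalLaw L hv hκ hθ hθ1 ht₀ hvol
  have hK : Tendsto (fun b : ℝ => K * b ^ (-θ'')) atTop (𝓝 0) := by
    have h1 := (tendsto_rpow_neg_atTop hθ'').const_mul K
    rw [mul_zero] at h1
    exact h1
  -- the window condition `L ≤ β^a` holds at fixed `L` for all large `β`
  have hwin : ∀ᶠ β : ℝ in atTop, (L : ℝ) ≤ β ^ a :=
    (tendsto_rpow_atTop ha).eventually_ge_atTop (L : ℝ)
  obtain ⟨β₀, hβ₀⟩ := (((hK.eventually (Iic_mem_nhds (by norm_num : (0 : ℝ) < 1 / 8))).and hwin).and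
    ((eventually_ge_atTop β₂).and (eventually_ge_atTop βp))).exists_forall_of_atTop
  refine ⟨β₀, fun β hβ => ?_⟩
  obtain ⟨⟨hsmall, hLa⟩, ⟨hb2, hbp⟩⟩ := hβ₀ β hβ
  have hsmall' : K * β ^ (-θ'') ≤ 1 / 8 := hsmall
  have hS := abs_le.1 ((hswap β hb2).trans hsmall')
  have hP := hper β hbp L hL hLa
  linarith [hS.2, hP]

end Summit.QuantumFields.YangMills.Theorems.SwapVirialDeficit.SwapRing

end
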